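import Summits.BirchSwinnertonDyer.BirchSwinnertonDyer.Theorems.KolyvaginRankRigidityAtTwoRegularRefillAtRegularStep
import Summits.BirchSwinnertonDyer.BirchSwinnertonDyer.Theorems.KolyvaginRankRigidityAtTwoWalkStepLocal
import Summits.BirchSwinnertonDyer.BirchSwinnertonDyer.Theorems.KolyvaginRankRigidityAtTwoWalkStepRefillClass
import HarnessLib

/-!
# Crux U1 `KolyvaginBoundedDefectAtTwo` (stmt-BirchSwinnertonDyer-28083), LINE 17 `regular_core_rigidity` v3,
# stub S1b `stub_nearCoreExistenceAtTwo` — ONE STEP OF THE WALK, LOCAL CONSEQUENCES VI: the PURE step (one cutter)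
# produces a refill class of large local order generating the new local images up to `2^j`

Width seat `bsd-line-krr2-p2` g14 (ONE READER on S1b); `--supports stmt-BirchSwinnertonDyer-28083` (helper). THEOREMS
ONLY; nothing here proves S1b, U1, a rung or BSD. BSD is NOT proved.

## Setting (g13's, `…RegularRefillAtRegularStep`)
`𝓛 = 𝓕(c)`, a regular place `v ∣ ℓ ∣ c`, `S = H¹_{𝓛[v ↦ Kum_v]}` (previous vertex) with an `s`-eigenclass cutter
`p ∈ S` of local order `2^(k−j)` and the FRAME property `2^J • loc_v(S) ⊆ ℤ loc_v p` (the other frame classes are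
killed at `v`); `S' = H¹_{𝓛}` (new vertex), `B = loc_v(S')`.
* abstract `natCard_le_of_nsmul_mem_zmultiples` (`#A ≤ #(H ∩ ker N) · #ℤz` if `N A ⊆ ℤz`, `A ≤ H`) and
  `exists_mem_generator_natCard_map_le` (the refill-class lemma of `…WalkStepRefillClass` WITH the generator clause
  `2^j B = ℤ(2^j loc r)`);
* `natCard_kummer_eq_pow` — `#Kum_v = 2^(2k)` at a Kolyvagin place of index `≥ k` (`Kum_v = H¹_ur ≃ E[2^k]`, as in the
  LEAD's `…SwapAuxClassLocalAtTwo`);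
* **`exists_refill_class_of_pureCut`** — some `r ∈ S'` has `2^j • loc_v u ∈ ℤ(2^j • loc_v r)` for every `u ∈ S'` and
  `2^k ≤ 2^(6j+2J+6) · addOrderOf (loc_v r)`: the cut inequality, the refill law (p686831), `#Kum_v = 4^k`,
  `#loc_v(S) ≤ 2·4^J·2^k` and `#B ≤ 2·4^j · addOrderOf (loc_v r)`; only LOCAL cardinalities and the ratio
  `#S/#S' = #loc_v(S)/#B` enter. With `…WalkStepSign` the class `q = τ_* r − s•r` is the walk's new frame class.
References (locators only; no cited FACT is declared): [cite: MazurRubin2004, §4.1, Prop. 4.1.5]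
[cite: Jetchev2008, §3.2 (2), Lemma 5.2] [cite: GrossLMS1991, §3 (3.1)–(3.4)].
Design: no definitions; `K : Type`; axioms `propext`, `Classical.choice`, `Quot.sound`.
-/

set_option autoImplicit false
-- the Theorems namespace of this sub repeats the summit name by design (D-0017 nested layout)
set_option linter.dupNamespace false

noncomputable section

open scoped Classical
open Function NumberField IsDedekindDomain WeierstrassCurve Field
open Literature.NumberTheory.EllipticCurves Literature.NumberTheory.EllipticCurves.Jetchev2008
open Literature.NumberTheory.GaloisRepresentations Literature.NumberTheory.GaloisCohomology
open Literature.NumberTheory.GaloisRepresentations.DiscreteGaloisModule (localTatePairingZMod tateDual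
  transverseSubgroup SelmerStructure)
open Literature.NumberTheory.Automorphic
open Summit.BirchSwinnertonDyer.Rank1Residual
open Summit.BirchSwinnertonDyer.Rank1Residual.JET.RingClassTransverse
open Summit.BirchSwinnertonDyer.Rank1Residual.JET.SelmerVocabulary
open Summit.BirchSwinnertonDyer.Rank1Residual.X11b.Relaxation (invWeilPairing invWeilPairing_apply
  invWeilPairing_eq_zero_of_mem)
open Summit.BirchSwinnertonDyer.BirchSwinnertonDyer.Theorems.KolyvaginLowerBoundAtTwo
open Summit.BirchSwinnertonDyer.Rank1Residual.JET.Section6 (card_eq_card_inf_ker_mul_card_map card_map_mul_card_map_le)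

namespace Summit.BirchSwinnertonDyer.BirchSwinnertonDyer.Theorems.KolyvaginAtTwo.RegularRefill

variable {K : Type} [Field K] [NumberField K] (W : WeierstrassCurve ℚ) [W.IsElliptic] [W.IsGloballyMinimal]
  (k : ℕ)
  (e : geomTorsion (W.baseChange K) ((2 ^ k : ℕ) : ℤ) → geomTorsion (W.baseChange K) ((2 ^ k : ℕ) : ℤ) →
    AlgebraicClosure K)
  (hμ : ∀ S T, e S T ^ (2 ^ k) = 1)
  (hadd₁ : ∀ S₁ S₂ T, e (S₁ + S₂) T = e S₁ T * e S₂ T)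
  (hadd₂ : ∀ S T₁ T₂, e S (T₁ + T₂) = e S T₁ * e S T₂)
  (hgal : ∀ (g : absoluteGaloisGroup K) (S T : geomTorsion (W.baseChange K) ((2 ^ k : ℕ) : ℤ)),
    g • e S T = e (g • S) (g • T))
  (halt : ∀ T, e T T = 1) (hnondeg : ∀ T, (∀ S, e S T = 1) → T = 0)
  (inv : LocalInvariants K (2 ^ k))
  (hK : IsImaginaryQuadratic K) (hD : NumberField.discr K < -4) (ι : K →+* ℂ)
  [∀ j : ℕ, NumberField (ringClassField K ι j)] (hk : 1 ≤ k)
  (c : ℕ) (hc : Squarefree c)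
  (hkol : ∀ ℓ ∈ c.primeFactors, Zhang2014.IsKolyvaginPrime (W.conductorNorm ℤ) W K 2 ℓ)
  (hkM : ∀ ℓ ∈ c.primeFactors, k + 1 ≤ Zhang2014.kolyvaginIndex W 2 ℓ)
  (𝒯 : SelmerStructure ((W.baseChange K).torsionGaloisModule ((2 ^ k : ℕ) : ℤ)))
  (h𝒯 : ∀ v : HeightOneSpectrum (𝓞 K), 𝒯 (Sum.inr v) =
    ⨅ ℓ ∈ c.primeFactors.filter (fun ℓ : ℕ ↦ ((ℓ : ℕ) : 𝓞 K) ∈ v.asIdeal),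
      ⨅ (w' : HeightOneSpectrum (𝓞 (ringClassField K ι ℓ))) (_ : w'.asIdeal.LiesOver v.asIdeal),
        letI := (adicCompletionOfLiesOver K (ringClassField K ι ℓ) v w').toAlgebra
        transverseSubgroup (GaloisRep.toLocal v ((W.baseChange K).torsionGaloisModule ((2 ^ k : ℕ) : ℤ)))
          (w'.adicCompletion (ringClassField K ι ℓ)))
  (hperf : inv.IsPerfect) (hvan : inv.SumLocalTermEqZero) (hcomp : inv.SelmerComplement)
  {ℓ : ℕ} (hℓc : ℓ ∈ c.primeFactors)
  (hreg : ∃ (v₁ : HeightOneSpectrum (𝓞 ℚ)) (𝔓₁ : Ideal (absIntegers (𝓞 ℚ) ℚ)) (h : absoluteGaloisGroup ℚ),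
    (ℓ : 𝓞 ℚ) ∈ v₁.asIdeal ∧ 𝔓₁ ∈ v₁.primesAbove ∧ IsArithFrobAt (𝓞 ℚ) h 𝔓₁ ∧
    (∀ X : geomTorsion W ((2 ^ k : ℕ) : ℤ), h • h • X = X) ∧
    ∃ P : geomTorsion W ((2 ^ k : ℕ) : ℤ), (2 : ℤ) ^ (k - 1) • (P + h • P) ≠ 0)
  (v : HeightOneSpectrum (𝓞 K)) (hv : (ℓ : 𝓞 K) ∈ v.asIdeal)
  {τ : K ≃ₐ[ℚ] K} (hτ1 : τ ≠ 1) (hfix : τ • v = v) {s : ℤ} (hs : s = 1 ∨ s = -1)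

/-! ### §1 Abstract bricks -/

section PureBricks

variable {L : Type*} [AddCommGroup L]

/-- If `N • A ⊆ ℤz` and `A ≤ H` then `#A ≤ #(H ∩ ker N) · #ℤz`. [folklore] -/
theorem natCard_le_of_nsmul_mem_zmultiples [Finite L] (A H : AddSubgroup L) (hAH : A ≤ H) (N : ℕ) (z : L)
    (h : ∀ a ∈ A, N • a ∈ AddSubgroup.zmultiples z) :
    Nat.card A ≤ Nat.card ↥(H ⊓ (nsmulAddMonoidHom N : L →+ L).ker) * Nat.card (AddSubgroup.zmultiples z) := by
  rw [card_eq_card_inf_ker_mul_card_map (nsmulAddMonoidHom N : L →+ L) A]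
  refine Nat.mul_le_mul (AddSubgroup.card_le_of_le (inf_le_inf_right _ hAH)) (AddSubgroup.card_le_of_le ?_)
  rintro _ ⟨a, ha, rfl⟩
  exact h a ha

variable {n : ℕ} (b : L →+ L →+ ZMod n)
  (hsymm : ∀ x y, b x y = b y x)
  {Hf Htr : AddSubgroup L} (hcod : Hf ⊔ Htr = ⊤)
  (hHtr : ∀ x ∈ Htr, ∀ y ∈ Htr, b x y = 0)

include hsymm hcod hHtr in
/-- The refill-class lemma `exists_mem_natCard_map_le_mul_addOrderOf` (p688438) WITH the generator clause: some
`r ∈ S'` has `2^j • loc u ∈ ℤ(2^j • loc r)` for all `u ∈ S'` and `#loc(S') ≤ #(H_tr ∩ ker 2^j) · addOrderOf (loc r)`.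
[cite: MazurRubin2004, §4.1, proof of Prop. 4.1.5] -/
theorem exists_mem_generator_natCard_map_le [Finite L] (hinj : Injective b) {cs e₀ : L}
    (hco : ∀ f ∈ Hf, ∃ m : ℤ, f - m • e₀ ∈ AddSubgroup.zmultiples cs)
    {G : Type*} [AddCommGroup G] (loc : G →+ L) (S' : AddSubgroup G) (j : ℕ)
    (hB : ∀ y ∈ S', loc y ∈ Htr) (hBcs : ∀ y ∈ S', b cs ((2 ^ j) • loc y) = 0) :
    ∃ r ∈ S', (∀ u ∈ S', ∃ t : ℤ, (2 ^ j) • loc u = t • ((2 ^ j) • loc r)) ∧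
      Nat.card (S'.map loc) ≤ Nat.card ↥(Htr ⊓ (nsmulAddMonoidHom (2 ^ j) : L →+ L).ker) * addOrderOf (loc r) := by
  set δ : L →+ L := nsmulAddMonoidHom (2 ^ j) with hδ
  set B := S'.map loc with hBdef
  set C := Htr ⊓ (b cs).ker with hCdef
  haveI : IsAddCyclic C := by
    refine isAddCyclic_of_injective ((b e₀).comp C.subtype) fun x y hxy ↦ ?_
    apply Subtype.ext
    rw [← sub_eq_zero]
    have hx : (x : L) ∈ Htr ⊓ (b cs).ker := x.2
    have hy : (y : L) ∈ Htr ⊓ (b cs).ker := y.2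
    refine eq_zero_of_apply_line_eq_zero b hsymm hcod hHtr hinj hco (Htr.sub_mem (AddSubgroup.mem_inf.mp hx).1
      (AddSubgroup.mem_inf.mp hy).1) ?_ ?_
    · rw [map_sub, (AddMonoidHom.mem_ker).mp (AddSubgroup.mem_inf.mp hx).2,
        (AddMonoidHom.mem_ker).mp (AddSubgroup.mem_inf.mp hy).2, sub_zero]
    · rw [map_sub, sub_eq_zero]; exact hxy
  have hle : B.map δ ≤ C := by
    rintro _ ⟨_, ⟨y, hy, rfl⟩, rfl⟩
    exact AddSubgroup.mem_inf.mpr ⟨Htr.nsmul_mem (hB y hy) _, (AddMonoidHom.mem_ker).mpr (hBcs y hy)⟩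
  haveI : IsAddCyclic ↥(B.map δ) := AddSubgroup.isAddCyclic_of_le hle
  obtain ⟨g, hg⟩ := (AddSubgroup.isAddCyclic_iff_exists_zmultiples_eq_top (B.map δ)).mp inferInstance
  have hgmem : g ∈ B.map δ := by rw [← hg]; exact AddSubgroup.mem_zmultiples g
  obtain ⟨_, ⟨r, hr, rfl⟩, hgr⟩ := hgmem
  refine ⟨r, hr, fun u hu ↦ ?_, ?_⟩
  · have : δ (loc u) ∈ AddSubgroup.zmultiples g := by
      rw [hg]; exact ⟨loc u, ⟨u, hu, rfl⟩, rfl⟩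
    obtain ⟨t, ht⟩ := AddSubgroup.mem_zmultiples_iff.mp this
    exact ⟨t, by rw [← hgr] at ht; exact ht.symm⟩
  have hcount : Nat.card B = Nat.card ↥(B ⊓ δ.ker) * Nat.card ↥(B.map δ) := card_eq_card_inf_ker_mul_card_map δ B
  have h1 : Nat.card ↥(B ⊓ δ.ker) ≤ Nat.card ↥(Htr ⊓ δ.ker) :=
    AddSubgroup.card_le_of_le (inf_le_inf_right _ (by rintro _ ⟨y, hy, rfl⟩; exact hB y hy))
  have h2 : Nat.card ↥(B.map δ) ≤ addOrderOf (loc r) := by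
    rw [← hg, Nat.card_zmultiples, ← hgr]
    exact Nat.le_of_dvd (addOrderOf_pos _) (addOrderOf_smul_dvd (2 ^ j))
  rw [hcount]
  exact Nat.mul_le_mul h1 h2

end PureBricks

/-! ### §2 In situ -/

include hK hkol hkM hℓc hv in
/-- **`#Kum_v = 2^(2k)`** at a place over a Zhang–Kolyvagin prime of index `≥ k` (`Kum_v = H¹_ur ≃ E[2^k](K̄)` by the
evaluation at Frobenius; as in the LEAD's `…SwapAuxClassLocalAtTwo`). [cite: GrossLMS1991, §3 (3.1)–(3.4)]
[cite: Jetchev2008, §3.2 (2)] -/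
theorem natCard_kummer_eq_pow [NeZero (2 ^ k)] [Finite (geomTorsion (W.baseChange K) ((2 ^ k : ℕ) : ℤ))] :
    Nat.card ((W.baseChange K).kummerSelmerStructure ((2 ^ k : ℕ) : ℤ) (Sum.inr v : Place K)) = 2 ^ (2 * k) := by
  have hℓ := hkol ℓ hℓc
  have hkℓ : k ≤ Zhang2014.kolyvaginIndex W 2 ℓ := Nat.le_of_succ_le (hkM ℓ hℓc)
  haveI : Fact (Nat.Prime 2) := ⟨Nat.prime_two⟩
  obtain ⟨hgood, hpv⟩ := JET.GlobalDuality.hasGoodReductionAt_of_zhangKolyvaginPrime W K hℓ v hv 1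
  have hpv' : ((2 : ℕ) : 𝓞 K) ∉ v.asIdeal := by rwa [pow_one, Int.cast_natCast] at hpv
  have hKumEq : ((W.baseChange K).kummerSelmerStructure ((2 ^ k : ℕ) : ℤ) (Sum.inr v : Place K)) =
      DiscreteGaloisModule.unramifiedSubgroup (GaloisRep.toLocal v ((W.baseChange K).torsionGaloisModule
        ((2 ^ k : ℕ) : ℤ))) 1 := by
    rw [X11b.KummerPT.kummerSelmerStructure_inr_eq_unramifiedSubgroup (W.baseChange K) 2 k hpv' hgood]
  obtain ⟨φ, hφ⟩ := exists_isAbsArithFrob_holds (v.adicCompletion K)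
  have hφ1 : IsFrobPow φ 1 := IsAbsArithFrob.isFrobPow_holds hφ
  obtain ⟨eK, -, -⟩ := exists_addEquiv_unramified_eval
    (GaloisRep.toLocal v ((W.baseChange K).torsionGaloisModule ((2 ^ k : ℕ) : ℤ)))
    (JET.GlobalDuality.galoisRep_toLocal_apply_eq_self W K hK hℓ hkℓ v hv) hφ1
    (AddMonoidHom.id _) (AddMonoidHom.id _) id (fun ψ => ⟨ψ, rfl, fun _ => rfl⟩) hφ1 (fun _ h => h)
  have eK' : ((W.baseChange K).kummerSelmerStructure ((2 ^ k : ℕ) : ℤ) (Sum.inr v : Place K)) ≃+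
      geomTorsion (W.baseChange K) ((2 ^ k : ℕ) : ℤ) := (AddEquiv.addSubgroupCongr hKumEq).trans eK
  rw [Nat.card_congr eK'.toEquiv, mul_comm, pow_mul]
  exact card_torsionPoints_eq_sq_holds (W.baseChange K) (AlgebraicClosure K) (n := 2 ^ k)
    (by exact_mod_cast pow_ne_zero k two_ne_zero)

include hμ hadd₁ hadd₂ hgal hK hD hk hc hkol hkM h𝒯 halt hnondeg hperf hvan hcomp hℓc hreg hv hτ1 hfix hs in
/-- **PURE STEP: A REFILL CLASS GENERATING THE NEW LOCAL IMAGES, OF LARGE LOCAL ORDER.** With an `s`-eigenclass cutter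
`p ∈ S` of local order `2^(k−j)` and the frame property `2^J • loc_v(S) ⊆ ℤ loc_v p`: some `r` of the new vertex
`S' = H¹_{𝓛}` has `2^j • loc_v u ∈ ℤ(2^j • loc_v r)` for all `u ∈ S'` and `2^k ≤ 2^(6j+2J+6) · addOrderOf (loc_v r)`.
[cite: MazurRubin2004, §4.1, Prop. 4.1.5] [cite: Jetchev2008, Lemma 5.2] -/
theorem exists_refill_class_of_pureCut [NeZero (2 ^ k)] [Finite (geomTorsion (W.baseChange K) ((2 ^ k : ℕ) : ℤ))]
    [Finite (SelmerStructure.selmerGroup (Function.update (selmerF W ((2 ^ k : ℕ) : ℤ) 𝒯 (placesDividing K c))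
      (Sum.inr v : Place K) ((W.baseChange K).kummerSelmerStructure ((2 ^ k : ℕ) : ℤ) (Sum.inr v : Place K)) :
      SelmerStructure ((W.baseChange K).torsionGaloisModule ((2 ^ k : ℕ) : ℤ))))]
    {j J : ℕ} (hjk : j ≤ k)
    {p : galoisCohomology ((W.baseChange K).torsionGaloisModule ((2 ^ k : ℕ) : ℤ)) 1}
    (hp : p ∈ SelmerStructure.selmerGroup (Function.update (selmerF W ((2 ^ k : ℕ) : ℤ) 𝒯 (placesDividing K c))
      (Sum.inr v : Place K) ((W.baseChange K).kummerSelmerStructure ((2 ^ k : ℕ) : ℤ) (Sum.inr v : Place K)) :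
      SelmerStructure ((W.baseChange K).torsionGaloisModule ((2 ^ k : ℕ) : ℤ))))
    (hpτ : conjAct W τ ((2 ^ k : ℕ) : ℤ) p = s • p)
    (hpord : addOrderOf (galoisCohomology.localization ((W.baseChange K).torsionGaloisModule ((2 ^ k : ℕ) : ℤ))
      (Sum.inr v : Place K) 1 p) = 2 ^ (k - j))
    (hAp : ∀ u ∈ SelmerStructure.selmerGroup (Function.update (selmerF W ((2 ^ k : ℕ) : ℤ) 𝒯 (placesDividing K c))
      (Sum.inr v : Place K) ((W.baseChange K).kummerSelmerStructure ((2 ^ k : ℕ) : ℤ) (Sum.inr v : Place K)) :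
      SelmerStructure ((W.baseChange K).torsionGaloisModule ((2 ^ k : ℕ) : ℤ))),
      (2 ^ J) • galoisCohomology.localization ((W.baseChange K).torsionGaloisModule ((2 ^ k : ℕ) : ℤ))
        (Sum.inr v : Place K) 1 u ∈ AddSubgroup.zmultiples (galoisCohomology.localization
          ((W.baseChange K).torsionGaloisModule ((2 ^ k : ℕ) : ℤ)) (Sum.inr v : Place K) 1 p)) :
    ∃ r ∈ (selmerF W ((2 ^ k : ℕ) : ℤ) 𝒯 (placesDividing K c)).selmerGroup,
      (∀ u ∈ (selmerF W ((2 ^ k : ℕ) : ℤ) 𝒯 (placesDividing K c)).selmerGroup, ∃ t : ℤ,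
        (2 ^ j) • galoisCohomology.localization ((W.baseChange K).torsionGaloisModule ((2 ^ k : ℕ) : ℤ))
          (Sum.inr v : Place K) 1 u =
        t • ((2 ^ j) • galoisCohomology.localization ((W.baseChange K).torsionGaloisModule ((2 ^ k : ℕ) : ℤ))
          (Sum.inr v : Place K) 1 r)) ∧
      2 ^ k ≤ 2 ^ (6 * j + 2 * J + 6) * addOrderOf (galoisCohomology.localization
        ((W.baseChange K).torsionGaloisModule ((2 ^ k : ℕ) : ℤ)) (Sum.inr v : Place K) 1 r) := by
  haveI : Finite (galoisCohomology ((((W.baseChange K).torsionGaloisModule ((2 ^ k : ℕ) : ℤ))).toLocal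
      (Sum.inr v : Place K)) 1) := finite_galoisCohomology_one_toLocal _ v
  haveI : ∀ w : Place K, CompactSpace (absoluteGaloisGroup (Place.Completion w)) :=
    fun w ↦ absoluteGaloisGroup_compactSpace _
  have hinv : Injective (inv (Sum.inr v)) := (hperf v).1.1
  have hvc : v ∈ placesDividing K c := mem_placesDividing_of_mem_primeFactors hc hℓc v hv
  have hℓ := hkol ℓ hℓc
  have hkℓ : k ≤ Zhang2014.kolyvaginIndex W 2 ℓ := Nat.le_of_succ_le (hkM ℓ hℓc)
  obtain ⟨⟨cs, -, hcsord, hline⟩, e₀, -, hco⟩ := kummer_regular_eigen_at_two W K hK hk hℓ hkℓ hreg v hv hτ1 hfix hs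
  set 𝓛 := selmerF W ((2 ^ k : ℕ) : ℤ) 𝒯 (placesDividing K c) with h𝓛
  set loc := galoisCohomology.localization ((W.baseChange K).torsionGaloisModule ((2 ^ k : ℕ) : ℤ))
    (Sum.inr v : Place K) 1 with hloc
  set Kum := (W.baseChange K).kummerSelmerStructure ((2 ^ k : ℕ) : ℤ) (Sum.inr v : Place K) with hKum
  set Rel := SelmerStructure.selmerGroup (Function.update 𝓛 (Sum.inr v : Place K) ⊤ :
    SelmerStructure ((W.baseChange K).torsionGaloisModule ((2 ^ k : ℕ) : ℤ))) with hRel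
  set S := SelmerStructure.selmerGroup (Function.update 𝓛 (Sum.inr v : Place K) Kum :
    SelmerStructure ((W.baseChange K).torsionGaloisModule ((2 ^ k : ℕ) : ℤ))) with hSdef
  -- the eigenclass `p`: `loc p ∈ X ∩ ℤc_s`, `2^j c_s ∈ ℤ loc p ⊆ X`
  have hS : S = Rel ⊓ Kum.comap loc := selmerGroup_update_eq_inf_comap W k 𝓛 v _
  have hp' := hp
  rw [hS] at hp'
  obtain ⟨hpRel, hpKum⟩ := AddSubgroup.mem_inf.mp hp'
  have hpKum' : loc p ∈ Kum := AddSubgroup.mem_comap.mp hpKum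
  have hpeig : loc p ∈ Kum ⊓ (conjActPlace W τ ((2 ^ k : ℕ) : ℤ) hfix - s • AddMonoidHom.id _).ker := by
    refine AddSubgroup.mem_inf.mpr ⟨hpKum', (AddMonoidHom.mem_ker).mpr ?_⟩
    rw [AddMonoidHom.sub_apply, AddMonoidHom.smul_apply, AddMonoidHom.id_apply, sub_eq_zero, hloc,
      conjActPlace_localization, hpτ, map_zsmul]
  have hgen : (2 ^ j) • cs ∈ AddSubgroup.zmultiples (loc p) :=
    two_pow_nsmul_mem_zmultiples_of_addOrderOf hcsord ((hline _).mp hpeig) hjk hpord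
  have hpX : loc p ∈ Rel.map loc := AddSubgroup.mem_map.mpr ⟨p, hpRel, rfl⟩
  have hgenX : (2 ^ j) • cs ∈ Rel.map loc := (AddSubgroup.zmultiples_le.mpr hpX) hgen
  have h𝓛v : 𝓛 (Sum.inr v) = 𝒯 (Sum.inr v) := by rw [h𝓛, selmerF_inr, if_pos hvc]
  have hS' : 𝓛.selmerGroup = Rel ⊓ (𝒯 (Sum.inr v)).comap loc := by
    have h := selmerGroup_update_eq_inf_comap W k 𝓛 v (𝒯 (Sum.inr v))
    have hupd : Function.update 𝓛 (Sum.inr v : Place K) (𝒯 (Sum.inr v)) = 𝓛 := by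
      rw [← h𝓛v, Function.update_eq_self]
    rw [hupd] at h
    exact h
  have hX := isotropic_map_localization_relaxed_selmerF W k e hμ hadd₁ hadd₂ hgal halt hnondeg inv hK hD ι hk c hc hkol
    hkM 𝒯 h𝒯 hperf hvan v hvc
  have hco' : ∀ f ∈ Kum, ∃ m : ℤ, f - m • e₀ ∈ AddSubgroup.zmultiples cs := fun f hf ↦ by
    obtain ⟨m, hm⟩ := hco f hf
    exact ⟨m, (hline _).mp hm⟩
  -- the refill class with the generator clause
  obtain ⟨r, hr, hgenr, hle⟩ := exists_mem_generator_natCard_map_le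
    (invWeilPairing (W.baseChange K) (2 ^ k) e hμ hadd₁ hadd₂ hgal inv (Sum.inr v))
    (fun x y ↦ AdditiveKoly.LagrangianSwitchAtP.invWeilPairing_symm (W.baseChange K) (2 ^ k) e hμ hadd₁ hadd₂ hgal
      halt inv (Sum.inr v) x y)
    (kummer_sup_transverse_eq_top_two W k hK hD ι hk c hc hkol hkM 𝒯 h𝒯 v hvc)
    (fun x hx y hy ↦ transverse_isotropic_two W k e hμ hadd₁ hadd₂ hgal halt hnondeg inv hK hD ι hk c hc hkol hkM 𝒯
      h𝒯 hperf v hvc hx hy)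
    (invWeilPairing_injective_of_symm W k e hμ hadd₁ hadd₂ hgal halt hnondeg inv v hinv) hco' loc 𝓛.selmerGroup j
    (fun y hy ↦ by rw [hS'] at hy; exact AddSubgroup.mem_comap.mp (AddSubgroup.mem_inf.mp hy).2)
    (fun y hy ↦ by
      rw [hS'] at hy
      have hyX : loc y ∈ Rel.map loc := AddSubgroup.mem_map.mpr ⟨y, (AddSubgroup.mem_inf.mp hy).1, rfl⟩
      rw [map_nsmul, ← AddMonoidHom.nsmul_apply, ← map_nsmul]
      exact hX _ hgenX _ hyX)
  refine ⟨r, hr, hgenr, ?_⟩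
  -- ### counting
  -- `#(𝒯_v ∩ ker 2^j) ≤ 2·4^j`
  have hTtors : Nat.card ↥(𝒯 (Sum.inr v) ⊓ (nsmulAddMonoidHom (2 ^ j) : _ →+ _).ker) ≤ 2 * 2 ^ j * 2 ^ j :=
    (natCard_inf_ker_le_of_pair
      (invWeilPairing (W.baseChange K) (2 ^ k) e hμ hadd₁ hadd₂ hgal inv (Sum.inr v))
      (X11b.KummerPT.nsmul_galoisCohomology_toLocal_eq_zero (W.baseChange K) (2 ^ k) (Sum.inr v))
      (fun x y ↦ AdditiveKoly.LagrangianSwitchAtP.invWeilPairing_symm (W.baseChange K) (2 ^ k) e hμ hadd₁ hadd₂ hgal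
        halt inv (Sum.inr v) x y)
      (kummer_sup_transverse_eq_top_two W k hK hD ι hk c hc hkol hkM 𝒯 h𝒯 v hvc)
      (fun x hx y hy ↦ invWeilPairing_eq_zero_of_mem (W.baseChange K) (2 ^ k) e hμ hadd₁ hadd₂ hgal halt inv
        (Sum.inr v) hx hy)
      (fun x hx y hy ↦ transverse_isotropic_two W k e hμ hadd₁ hadd₂ hgal halt hnondeg inv hK hD ι hk c hc hkol hkM 𝒯
        h𝒯 hperf v hvc hx hy)
      (invWeilPairing_injective_of_symm W k e hμ hadd₁ hadd₂ hgal halt hnondeg inv v hinv) (2 ^ j)).trans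
      (natCard_kummer_inf_ker_le W k hK hk c hkol hkM hℓc hreg v hv hτ1 hfix (2 ^ j) (by positivity))
  -- `#B ≤ 2·4^j · ord(loc r)`
  have hB : Nat.card (𝓛.selmerGroup.map loc) ≤ 2 * 2 ^ j * 2 ^ j * addOrderOf (loc r) :=
    hle.trans (Nat.mul_le_mul_right _ hTtors)
  -- `#A ≤ 2·4^J·2^k`
  have hA : Nat.card (S.map loc) ≤ 2 * 2 ^ J * 2 ^ J * 2 ^ k := by
    have h1 := natCard_le_of_nsmul_mem_zmultiples (S.map loc) Kum
      (by rintro _ ⟨u, hu, rfl⟩; rw [hS] at hu; exact AddSubgroup.mem_comap.mp (AddSubgroup.mem_inf.mp hu).2)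
      (2 ^ J) (loc p) (by rintro _ ⟨u, hu, rfl⟩; exact hAp u hu)
    refine h1.trans (Nat.mul_le_mul (natCard_kummer_inf_ker_le W k hK hk c hkol hkM hℓc hreg v hv hτ1 hfix (2 ^ J)
      (by positivity)) ?_)
    rw [Nat.card_zmultiples, hpord]
    exact Nat.pow_le_pow_right (by norm_num) (Nat.sub_le k j)
  -- refill law and the common kernel
  have hRL := lozenge_refill_of_regular_eigenclass_upTo W k e hμ hadd₁ hadd₂ hgal halt hnondeg inv hK hD ι hk c hc hkol
    hkM 𝒯 h𝒯 hperf hvan hcomp hℓc hreg v hv hτ1 hfix hs hjk hp hpτ hpord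
  have hker : S ⊓ loc.ker = 𝓛.selmerGroup ⊓ loc.ker := by
    rw [hS, hS']
    ext z
    simp only [AddSubgroup.mem_inf, AddSubgroup.mem_comap, AddMonoidHom.mem_ker]
    constructor
    · rintro ⟨⟨hz, -⟩, h0⟩; exact ⟨⟨hz, by rw [h0]; exact AddSubgroup.zero_mem _⟩, h0⟩
    · rintro ⟨⟨hz, -⟩, h0⟩; exact ⟨⟨hz, by rw [h0]; exact AddSubgroup.zero_mem _⟩, h0⟩
  have hSc : Nat.card S = Nat.card ↥(S ⊓ loc.ker) * Nat.card (S.map loc) := card_eq_card_inf_ker_mul_card_map loc S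
  have hS'c : Nat.card 𝓛.selmerGroup = Nat.card ↥(𝓛.selmerGroup ⊓ loc.ker) * Nat.card (𝓛.selmerGroup.map loc) :=
    card_eq_card_inf_ker_mul_card_map loc _
  have hKumc : Nat.card Kum = 2 ^ (2 * k) := natCard_kummer_eq_pow W k hK c hkol hkM hℓc v hv
  have hpos : 0 < Nat.card ↥(S ⊓ loc.ker) * Nat.card (S.map loc) := by rw [← hSc]; exact Nat.card_pos
  -- `4^k ≤ 2^(4j+4) · #A · #B`
  have hmain : 2 ^ (2 * k) ≤ 2 ^ (4 * j + 4) * Nat.card (S.map loc) * Nat.card (𝓛.selmerGroup.map loc) := by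
    rw [hSc, hS'c, ← hker, hKumc] at hRL
    -- `hRL : (#S₀ · #A) · 4^k ≤ 2^(4j+4) · #A² · (#S₀ · #B)`
    have h1 : Nat.card ↥(S ⊓ loc.ker) * Nat.card (S.map loc) * 2 ^ (2 * k) ≤
        Nat.card ↥(S ⊓ loc.ker) * Nat.card (S.map loc) *
          (2 ^ (4 * j + 4) * Nat.card (S.map loc) * Nat.card (𝓛.selmerGroup.map loc)) := by
      calc _ ≤ _ := hRL
        _ = _ := by ring
    exact Nat.le_of_mul_le_mul_left h1 hpos
  -- conclude
  have h2 : 2 ^ (2 * k) ≤ 2 ^ (6 * j + 2 * J + 6) * addOrderOf (loc r) * 2 ^ k := by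
    calc 2 ^ (2 * k) ≤ 2 ^ (4 * j + 4) * Nat.card (S.map loc) * Nat.card (𝓛.selmerGroup.map loc) := hmain
      _ ≤ 2 ^ (4 * j + 4) * (2 * 2 ^ J * 2 ^ J * 2 ^ k) * (2 * 2 ^ j * 2 ^ j * addOrderOf (loc r)) :=
          Nat.mul_le_mul (Nat.mul_le_mul_left _ hA) hB
      _ = 2 ^ (6 * j + 2 * J + 6) * addOrderOf (loc r) * 2 ^ k := by ring
  rw [two_mul, pow_add] at h2
  exact Nat.le_of_mul_le_mul_right h2 (by positivity)

end Summit.BirchSwinnertonDyer.BirchSwinnertonDyer.Theorems.KolyvaginAtTwo.RegularRefill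

end
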